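import Summits.HodgeConjecture.HodgeConjecture.Theorems.R90S4HLdsOfKeys                  -- ★ p861828 (R90-C131-p05): the (TWO)∕(ORBIT) cut of S4#B5; brings ★ (STAB) `isConstituentOf_comap_cmDatumLocalCongr_cmPrincipalSeries`, ★ `formCongr_glDiagonal_two_eq_smul`, ★ F1 `comap_cmDatumLocalCongr_eq_of_eq_norm_mul`
import Summits.HodgeConjecture.HodgeConjecture.Theorems.R90S4HCard                      -- ★ p861543 (this seat): `formCongr_one_antidiag`; brings ★ `QuadraticLocalNormGroupNonsplit` (`exists_conjLocal_eq_not_exists_norm`, `exists_norm_mul_of_not_exists_norm`)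
import Literature.NumberTheory.Weil1982.UnitaryLocalRingBaseField                      -- ★ `UnitaryFinTopForm.exists_complexConj_eq_neg_ne_zero` (a purely imaginary `δ ≠ 0`, the `δ`-data of the `E_v`-currency lemmas)
import HarnessLib

/-!
# R90-TF · S4 (Rogawski Ch. 13.1–2) — S4#B5-ORBIT «OUTER SIMILITUDE SWAP»: the (ORBIT) input of socket `stub_R90_S4_H_lds`
# reduced to its printed core «a non-norm similitude moves the constituents» (Labesse–Langlands)

Cell `hodgecm-mathlib`, crux H413 (`stmt-HodgeConjecture-24833`, lane `--supports`), route of record `HCCMUnconditional` (no route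
verbs; count-neutral).  Programme R90-TF (brief `director/R90-BRIEF.v2.md`), section S4 = Ch. 13.1–2 (base `R90-C131`); seat R90-C131-p03
(g0), dealt BY NAME «p03 ← S4#B5-ORBIT `Theorems/R90S4U2OuterSimilSwap.lean`» (K2E2-plan (g6), `R90/STATUS.md` 2026-09-04T16:20:22Z).
THEOREMS ONLY (no `def`, no instance, no notation, no named fact, no `sorry`); imports ★ only (the by-write file
`Cruxes/H413/Lines/R90_S4_HPacketsU2B.lean` is NOT imported: its `U2Loc ∕ Φ₂Loc ∕ IsU2SimilConj` are unfolded byte for byte, as in ★ p05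
`R90S4HLdsOfKeys`).  HONEST LABEL: HC_CM is proved only modulo the 7 printed citations (2 remaining named inputs: hLiu418 =
stmt-HodgeConjecture-24832, h413 = stmt-HodgeConjecture-24833) until rung 0 closes; this file CLOSES NOTHING by itself — it SHARPENS the
named input (ORBIT) of ★ `stub_R90_S4_H_lds_of_two_of_orbit` to (SWAP) below; (SWAP) is p-adic harmonic analysis NOT in the tree.

PRINT [Rogawski1990, §11.1 p. 161]: «An L-packet on `G` [= `U(2)`] is, by definition, a `PGL₂(F)`-orbit in `E(G)` … `i_G(χ)` is irreducible
except … 2) `χ|F^* = ω_{E/F}` … In case 2), `χ` is unitary and `JH(i_G(χ))` is an l.d.s. L-packet» (proof: [LabesseLanglands1979] for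
`SL(2)`; the two constituents `π⁺, π⁻` are told apart by their Whittaker models `ψ` vs `ψ_{a₀}`, `a₀ ∉ N E^×`, and `Ad(diag(a₀, 1))` exchanges
them).  ★ p05 cut socket S4#B5 to (TWO) «`JH(i_G(χ))` has exactly two elements» and (ORBIT) «any two constituents are similitude-conjugate».
THIS FILE: (ORBIT) ⟸ (TWO) + ★(STAB) + (SWAP), where

  (SWAP)  at a non-split `v`, a local similitude `T` of `Φ₂` whose multiplier `a` is NOT a norm `σ(z) z` MOVES every constituent `π` of
          `i_G((χ₁, χ₂))` (`χ₁|F_v^× = ω`): `π ∘ Ad(T) ≠ π`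

— and (SWAP) is in turn implied by the a priori weaker «SOME similitude moves SOME constituent» (§4), so it is the exact residue.  The
group theory is ★: the orbit map factors through the multiplier class (★ F1 `comap_cmDatumLocalCongr_eq_of_eq_norm_mul`), `σ`-fixed units mod
norms have two classes at a non-split `v` (★ `exists_norm_mul_of_not_exists_norm`, O'Meara 63:13a in the tree), an OUTER similitude
`diag(a₀, 1)` with non-norm multiplier exists there (★ `exists_conjLocal_eq_not_exists_norm` + ★ `formCongr_glDiagonal_two_eq_smul`), every
similitude permutes `JH(i_G(χ))` (★ (STAB)), and `IrrClass.comap` is injective (★).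

CONTENTS.
* §1 `exists_similitude_not_exists_norm` — at a non-split `v` there is a similitude of `(Φ₂)_v` with NON-NORM multiplier (`diag(a₀, 1)`).
* §2 `comap_eq_self_of_outer_comap_eq_self` — INDEX-TWO REDUCTION: if ONE non-norm similitude fixes a class, EVERY similitude fixes it;
  contrapositive `swap_moves_of_one_moved`.
* §3 `orbit_of_two_of_exists_moved` — (TWO) + ★(STAB) + «one constituent is moved by one similitude» ⇒ (ORBIT) at `(v, χ)`.
* §4 `swap_of_two_of_exists_moved` — … ⇒ even (SWAP) at `(v, χ)` (sharpness: (SWAP) ⟺ «some mover» given (TWO)).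
* §5 `hOrbit_of_hTwo_of_swap` — under the socket's guards: ★ p05's `hTwo` binder + (SWAP) ⟹ ★ p05's `hOrbit` binder, TOKEN FOR TOKEN
  (so `stub_R90_S4_H_lds_of_two_of_orbit hTwo (hOrbit_of_hTwo_of_swap hTwo hSwap)` pays S4#B5 modulo (TWO) + (SWAP)).
DEPENDENCY CUT (CENSUS-FIRST): (SWAP) — [Rogawski1990 §11.1 p. 161 case 2); LabesseLanglands1979] — NOT in the tree (no Whittaker-model ∕
R-group analysis for `U(Φ₂)(L⁺_v)`); proposed B ED. 3 socket `stub_R90_S4_U2_outerSimilSwap` = the binder `hSwap` of §5 verbatim.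

## References
* [Rogawski1990] J. D. Rogawski, *Automorphic Representations of Unitary Groups in Three Variables*, Ann. of Math. Stud. 123 (1990): §11.1
  p. 161 (L-packets on `U(2)`; case 2); Prop. 11.1.1), §12.1 p. 171 case 2), §3.5 Prop. 3.5.2 (a) p. 29.
* [LabesseLanglands1979] J.-P. Labesse, R. P. Langlands, *L-indistinguishability for SL(2)*, Canad. J. Math. 31 (1979), 726–785.
* [Omeara1963] O. T. O'Meara, *Introduction to Quadratic Forms* (1963), §63B Prop. 63:13a.
* [BushnellHenniart2006] C. J. Bushnell, G. Henniart, *The Local Langlands Conjecture for GL(2)* (2006), §1.1.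
-/

set_option autoImplicit false
-- the mandated namespace repeats `HodgeConjecture.HodgeConjecture`, as in every `Theorems/*.lean` of this sub-problem
set_option linter.dupNamespace false

noncomputable section

open NumberField IsDedekindDomain
open scoped Matrix MatrixGroups

open Literature.NumberTheory.Automorphic Literature.NumberTheory.Automorphic.UnitaryGroup

namespace Summit.HodgeConjecture.HodgeConjecture.R90.S4

variable (L : Type) [Field L] [NumberField L] [IsCMField L]

/-! ## §1 At a non-split place an OUTER similitude exists: `diag(a₀, 1)`, `a₀ ∉ N(E_w^×)` -/

/-- **An outer similitude of `(Φ₂)_v` at a non-split `v`**: there is a local similitude `ᵗσ(T₀) (Φ₂)_v T₀ = a₀ (Φ₂)_v` whose multiplier `a₀`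
(a `σ`-fixed unit) is NOT a norm `σ(z) z` — namely `T₀ = diag(a₀, 1)` (★ `formCongr_glDiagonal_two_eq_smul`) for a non-norm `σ`-fixed unit
`a₀` (★ `exists_conjLocal_eq_not_exists_norm`, index two).  Its image in `PGL₂(F)` is the non-trivial element of `GU(Φ₂)(F) ∕ E^× U(Φ₂)(F) ≅
F^× ∕ N E^×`. [cite: Rogawski1990, §11.1 p. 161; §3.5 Prop. 3.5.2 (a) p. 29] [cite: Omeara1963, §63B Prop. 63:13a] -/
theorem exists_similitude_not_exists_norm (v : HeightOneSpectrum (𝓞 ↥(maximalRealSubfield L)))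
    (hv : ∀ w : PlacesOver L v, IsCMField.complexConj L • w.1 = w.1) :
    ∃ (T : GL (Fin 2) (LocalRing L v)) (a : LocalRing L v) (_ : IsUnit a)
      (_ : formCongr (conjLocal L (IsCMField.complexConj L) v) T
        ((Matrix.of fun i j : Fin 2 => if i.val + j.val + 1 = 2 then (1 : L) else 0).map (algebraMap L (LocalRing L v))) =
        a • (Matrix.of fun i j : Fin 2 => if i.val + j.val + 1 = 2 then (1 : L) else 0).map (algebraMap L (LocalRing L v))),
      ¬ ∃ z : LocalRing L v, IsUnit z ∧ a = conjLocal L (IsCMField.complexConj L) v z * z := by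
  obtain ⟨δ, hcδ, hδ⟩ := Literature.NumberTheory.Weil1982.UnitaryFinTopForm.exists_complexConj_eq_neg_ne_zero L
  obtain ⟨w⟩ : Nonempty (PlacesOver L v) := inferInstance
  obtain ⟨r, hr, hru, hnr⟩ := exists_conjLocal_eq_not_exists_norm L v (IsCMField.complexConj L) hcδ hδ w (hv w)
  exact ⟨_, r, hru, formCongr_glDiagonal_two_eq_smul L v hru hr, hnr⟩

/-! ## §2 Index-two reduction: one non-norm similitude fixing a class ⇒ every similitude fixes it -/

/-- **INDEX-TWO REDUCTION.**  At a non-split `v`, let `T₀` be a similitude of `(Φ₂)_v` with NON-NORM multiplier `a₀` that FIXES the class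
`π` (`π ∘ Ad(T₀) = π`).  Then EVERY similitude `T` fixes `π`: its multiplier `a` is `σ`-fixed (★ `conjLocal_eq_self_of_formCongr_eq_smul_antidiag`);
if `a = σ(z) z` is a norm, `T` is in the class of `1` and `π ∘ Ad(T) = π ∘ Ad(1) = π` (★ F1); if not, `a = σ(z) z · a₀` by index two (★
`exists_norm_mul_of_not_exists_norm`) and `π ∘ Ad(T) = π ∘ Ad(T₀) = π` (★ F1).  [cite: Rogawski1990, §11.1 p. 161; §3.5 Prop. 3.5.2 (a) p. 29]
[cite: Omeara1963, §63B Prop. 63:13a] -/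
theorem comap_eq_self_of_outer_comap_eq_self (v : HeightOneSpectrum (𝓞 ↥(maximalRealSubfield L)))
    (hv : ∀ w : PlacesOver L v, IsCMField.complexConj L • w.1 = w.1)
    (T₀ : GL (Fin 2) (LocalRing L v)) {a₀ : LocalRing L v} (ha₀ : IsUnit a₀)
    (h₀ : formCongr (conjLocal L (IsCMField.complexConj L) v) T₀
      ((Matrix.of fun i j : Fin 2 => if i.val + j.val + 1 = 2 then (1 : L) else 0).map (algebraMap L (LocalRing L v))) =
      a₀ • (Matrix.of fun i j : Fin 2 => if i.val + j.val + 1 = 2 then (1 : L) else 0).map (algebraMap L (LocalRing L v)))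
    (hn₀ : ¬ ∃ z : LocalRing L v, IsUnit z ∧ a₀ = conjLocal L (IsCMField.complexConj L) v z * z)
    (π : IrrClass ((cmDatum L 2 (Matrix.of fun i j : Fin 2 => if i.val + j.val + 1 = 2 then (1 : L) else 0)).Local v))
    (hfix : IrrClass.comap (cmDatumLocalCongr L v T₀ ha₀ h₀) π = π)
    (T : GL (Fin 2) (LocalRing L v)) {a : LocalRing L v} (ha : IsUnit a)
    (h : formCongr (conjLocal L (IsCMField.complexConj L) v) T
      ((Matrix.of fun i j : Fin 2 => if i.val + j.val + 1 = 2 then (1 : L) else 0).map (algebraMap L (LocalRing L v))) =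
      a • (Matrix.of fun i j : Fin 2 => if i.val + j.val + 1 = 2 then (1 : L) else 0).map (algebraMap L (LocalRing L v))) :
    IrrClass.comap (cmDatumLocalCongr L v T ha h) π = π := by
  have haσ : conjLocal L (IsCMField.complexConj L) v a = a :=
    conjLocal_eq_self_of_formCongr_eq_smul_antidiag L two_ne_zero (antidiagOne_isHermitian L 2) v T h
  have ha₀σ : conjLocal L (IsCMField.complexConj L) v a₀ = a₀ :=
    conjLocal_eq_self_of_formCongr_eq_smul_antidiag L two_ne_zero (antidiagOne_isHermitian L 2) v T₀ h₀
  by_cases hn : ∃ z : LocalRing L v, IsUnit z ∧ a = conjLocal L (IsCMField.complexConj L) v z * z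
  · -- `T` is in the class of `1`
    obtain ⟨z, hz, hzz⟩ := hn
    rw [← comap_cmDatumLocalCongr_eq_of_eq_norm_mul L v 1 T isUnit_one ha (formCongr_one_antidiag L v) h hz
      (by rw [mul_one]; exact hzz) π]
    exact comap_cmDatumLocalCongr_eq_self_of_coe L v 1 isUnit_one (formCongr_one_antidiag L v) π
  · -- `T` is in the class of `T₀` (index two)
    obtain ⟨δ, hcδ, hδ⟩ := Literature.NumberTheory.Weil1982.UnitaryFinTopForm.exists_complexConj_eq_neg_ne_zero L
    obtain ⟨w⟩ : Nonempty (PlacesOver L v) := inferInstance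
    obtain ⟨z, hz, hzz⟩ := exists_norm_mul_of_not_exists_norm L v (IsCMField.complexConj L) hcδ hδ w (hv w) ha₀σ ha₀ haσ ha hn₀ hn
    rw [← comap_cmDatumLocalCongr_eq_of_eq_norm_mul L v T₀ T ha₀ ha h₀ h hz hzz π, hfix]

/-- **Contrapositive, pointwise (no (TWO) needed; the dealer's `swap_moves_of_one_moved`): a class MOVED by some similitude is moved by
EVERY similitude with non-norm multiplier** (non-split `v`). [cite: Rogawski1990, §11.1 p. 161]
[cite: Omeara1963, §63B Prop. 63:13a] -/
theorem swap_moves_of_one_moved (v : HeightOneSpectrum (𝓞 ↥(maximalRealSubfield L)))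
    (hv : ∀ w : PlacesOver L v, IsCMField.complexConj L • w.1 = w.1)
    (π : IrrClass ((cmDatum L 2 (Matrix.of fun i j : Fin 2 => if i.val + j.val + 1 = 2 then (1 : L) else 0)).Local v))
    (T : GL (Fin 2) (LocalRing L v)) {a : LocalRing L v} (ha : IsUnit a)
    (h : formCongr (conjLocal L (IsCMField.complexConj L) v) T
      ((Matrix.of fun i j : Fin 2 => if i.val + j.val + 1 = 2 then (1 : L) else 0).map (algebraMap L (LocalRing L v))) =
      a • (Matrix.of fun i j : Fin 2 => if i.val + j.val + 1 = 2 then (1 : L) else 0).map (algebraMap L (LocalRing L v)))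
    (hmove : IrrClass.comap (cmDatumLocalCongr L v T ha h) π ≠ π)
    (T₀ : GL (Fin 2) (LocalRing L v)) {a₀ : LocalRing L v} (ha₀ : IsUnit a₀)
    (h₀ : formCongr (conjLocal L (IsCMField.complexConj L) v) T₀
      ((Matrix.of fun i j : Fin 2 => if i.val + j.val + 1 = 2 then (1 : L) else 0).map (algebraMap L (LocalRing L v))) =
      a₀ • (Matrix.of fun i j : Fin 2 => if i.val + j.val + 1 = 2 then (1 : L) else 0).map (algebraMap L (LocalRing L v)))
    (hn₀ : ¬ ∃ z : LocalRing L v, IsUnit z ∧ a₀ = conjLocal L (IsCMField.complexConj L) v z * z) :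
    IrrClass.comap (cmDatumLocalCongr L v T₀ ha₀ h₀) π ≠ π :=
  fun hfix => hmove (comap_eq_self_of_outer_comap_eq_self L v hv T₀ ha₀ h₀ hn₀ π hfix T ha h)

/-! ## §3⁰ Two-element sets: an injective self-map moving one point swaps the two points (bookkeeping) -/

/-- In a two-element set `{p₁, p₂}`, two distinct members exhaust it. [folklore] -/
theorem pair_cases {α : Type*} {p₁ p₂ x y z : α} (hx : x = p₁ ∨ x = p₂) (hy : y = p₁ ∨ y = p₂) (hxy : x ≠ y)
    (hz : z = p₁ ∨ z = p₂) : z = x ∨ z = y := by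
  rcases hx with rfl | rfl <;> rcases hy with rfl | rfl <;> rcases hz with rfl | rfl <;>
    first | exact Or.inl rfl | exact Or.inr rfl | exact (hxy rfl).elim

/-- **An injective self-map of a two-element set that moves one point swaps the two points**: if `f` maps `{p₁, p₂}` into itself
injectively and `f x₀ ≠ x₀` for some member `x₀`, then `f x = y` for all distinct members `x, y`. [folklore] -/
theorem eq_apply_of_pair_of_moved {α : Type*} {p₁ p₂ : α} (f : α → α) (hinj : Function.Injective f)
    (hperm : ∀ z, z = p₁ ∨ z = p₂ → f z = p₁ ∨ f z = p₂) {x₀ : α} (hx₀ : x₀ = p₁ ∨ x₀ = p₂) (hmv : f x₀ ≠ x₀)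
    {x y : α} (hx : x = p₁ ∨ x = p₂) (hy : y = p₁ ∨ y = p₂) (hxy : x ≠ y) : y = f x := by
  -- `f x ∈ {x, y}`; rule out `f x = x`
  rcases pair_cases hx hy hxy (hperm x hx) with e | e
  · exfalso
    rcases pair_cases hx hy hxy hx₀ with rfl | rfl
    · exact hmv e
    · -- `x₀ = y`: `f y ∈ {x, y}` and `f y ≠ y` force `f y = x = f x`, so `x = y`
      rcases pair_cases hx hy hxy (hperm _ hy) with e' | e'
      · exact hxy (hinj (e.trans e'.symm))
      · exact hmv e'
  · exact e.symm

/-! ## §3 (TWO) + (STAB) + one mover ⇒ (ORBIT) -/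

/-- **(ORBIT) from (TWO), ★(STAB) and ONE MOVER.**  Let the constituents of `i(χ) = cmPrincipalSeries L 2 v χ` be `π₁, π₂` (TWO; `π₁ ≠ π₂`
is then automatic from the mover), and let some similitude `T` move some constituent `c₀` (`c₀ ∘ Ad(T) ≠ c₀`).  Since `Ad(T)` permutes `JH(i(χ)) = {π₁, π₂}` (★ (STAB)
`isConstituentOf_comap_cmDatumLocalCongr_cmPrincipalSeries`) and `IrrClass.comap` is injective (★), `Ad(T)` SWAPS `π₁, π₂`; with `Ad(1)`
for `c = c′` (★ `comap_cmDatumLocalCongr_eq_self_of_coe`), any two constituents are similitude-conjugate — the (ORBIT) binder of ★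
`lds_of_two_of_orbit` at `(v, χ)`. [cite: Rogawski1990, §11.1 p. 161] [cite: BushnellHenniart2006, §1.1] -/
theorem orbit_of_two_of_exists_moved (v : HeightOneSpectrum (𝓞 ↥(maximalRealSubfield L)))
    (χ : ↥(torusU (conjLocal L (IsCMField.complexConj L) v) (cmLocalForm L 2 v)) →* ℂˣ)
    {π₁ π₂ : IrrClass ((cmDatum L 2 (Matrix.of fun i j : Fin 2 => if i.val + j.val + 1 = 2 then (1 : L) else 0)).Local v)}
    (hcons : ∀ c, c.IsConstituentOf (cmPrincipalSeries L 2 v χ) ↔ c = π₁ ∨ c = π₂)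
    (hmoved : ∃ (c₀ : IrrClass ((cmDatum L 2 (Matrix.of fun i j : Fin 2 => if i.val + j.val + 1 = 2 then (1 : L) else 0)).Local v))
      (T : GL (Fin 2) (LocalRing L v)) (a : LocalRing L v) (ha : IsUnit a)
      (h : formCongr (conjLocal L (IsCMField.complexConj L) v) T
        ((Matrix.of fun i j : Fin 2 => if i.val + j.val + 1 = 2 then (1 : L) else 0).map (algebraMap L (LocalRing L v))) =
        a • (Matrix.of fun i j : Fin 2 => if i.val + j.val + 1 = 2 then (1 : L) else 0).map (algebraMap L (LocalRing L v))),
      c₀.IsConstituentOf (cmPrincipalSeries L 2 v χ) ∧ IrrClass.comap (cmDatumLocalCongr L v T ha h) c₀ ≠ c₀) :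
    ∀ c c' : IrrClass ((cmDatum L 2 (Matrix.of fun i j : Fin 2 => if i.val + j.val + 1 = 2 then (1 : L) else 0)).Local v),
      c.IsConstituentOf (cmPrincipalSeries L 2 v χ) → c'.IsConstituentOf (cmPrincipalSeries L 2 v χ) →
        ∃ (T : GL (Fin 2) (LocalRing L v)) (a : LocalRing L v) (ha : IsUnit a)
          (h : formCongr (conjLocal L (IsCMField.complexConj L) v) T
            ((Matrix.of fun i j : Fin 2 => if i.val + j.val + 1 = 2 then (1 : L) else 0).map (algebraMap L (LocalRing L v))) =
            a • (Matrix.of fun i j : Fin 2 => if i.val + j.val + 1 = 2 then (1 : L) else 0).map (algebraMap L (LocalRing L v))),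
          c' = IrrClass.comap (cmDatumLocalCongr L v T ha h) c := by
  obtain ⟨c₀, T, a, ha, h, hc₀, hmv⟩ := hmoved
  -- `Ad(T)` maps the pair `{π₁, π₂}` into itself (★ (STAB)), injectively (★ `IrrClass.comap_injective`), and moves `c₀`
  have hperm : ∀ z, z = π₁ ∨ z = π₂ →
      IrrClass.comap (cmDatumLocalCongr L v T ha h) z = π₁ ∨ IrrClass.comap (cmDatumLocalCongr L v T ha h) z = π₂ :=
    fun z hz => (hcons _).1 (isConstituentOf_comap_cmDatumLocalCongr_cmPrincipalSeries L v χ T a ha h ((hcons z).2 hz))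
  have hinj := IrrClass.comap_injective (cmDatumLocalCongr L v T ha h)
  intro c c' hc hc'
  by_cases hcc' : c = c'
  · subst hcc'
    exact ⟨1, 1, isUnit_one, formCongr_one_antidiag L v,
      (comap_cmDatumLocalCongr_eq_self_of_coe L v 1 isUnit_one (formCongr_one_antidiag L v) c).symm⟩
  · exact ⟨T, a, ha, h,
      eq_apply_of_pair_of_moved _ hinj hperm ((hcons c₀).1 hc₀) hmv ((hcons c).1 hc) ((hcons c').1 hc') hcc'⟩

/-! ## §4 Sharpness: (TWO) + (STAB) + one mover ⇒ (SWAP) at `(v, χ)` -/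

/-- **One mover forces the full (SWAP)** (non-split `v`): if `i(χ)` has exactly two constituents and some similitude moves one of them, then
EVERY similitude with non-norm multiplier moves EVERY constituent — were a constituent `π` fixed by a non-norm similitude, all similitudes
would fix `π` (§2), in particular the given mover `T`; but `T` swaps the pair (§3 reasoning: ★ (STAB) + injectivity), contradiction.  So, given
(TWO), the inputs «some mover», (ORBIT) and (SWAP) are EQUIVALENT; (SWAP) is the form printed facts deliver ([LabesseLanglands1979]: `π⁺` is
`ψ`-generic, `π⁻` is `ψ_{a₀}`-generic, `Ad(diag(a₀,1))` exchanges them). [cite: Rogawski1990, §11.1 p. 161] [cite: Omeara1963, §63B Prop. 63:13a] -/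
theorem swap_of_two_of_exists_moved (v : HeightOneSpectrum (𝓞 ↥(maximalRealSubfield L)))
    (hv : ∀ w : PlacesOver L v, IsCMField.complexConj L • w.1 = w.1)
    (χ : ↥(torusU (conjLocal L (IsCMField.complexConj L) v) (cmLocalForm L 2 v)) →* ℂˣ)
    {π₁ π₂ : IrrClass ((cmDatum L 2 (Matrix.of fun i j : Fin 2 => if i.val + j.val + 1 = 2 then (1 : L) else 0)).Local v)}
    (hcons : ∀ c, c.IsConstituentOf (cmPrincipalSeries L 2 v χ) ↔ c = π₁ ∨ c = π₂)
    (hmoved : ∃ (c₀ : IrrClass ((cmDatum L 2 (Matrix.of fun i j : Fin 2 => if i.val + j.val + 1 = 2 then (1 : L) else 0)).Local v))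
      (T : GL (Fin 2) (LocalRing L v)) (a : LocalRing L v) (ha : IsUnit a)
      (h : formCongr (conjLocal L (IsCMField.complexConj L) v) T
        ((Matrix.of fun i j : Fin 2 => if i.val + j.val + 1 = 2 then (1 : L) else 0).map (algebraMap L (LocalRing L v))) =
        a • (Matrix.of fun i j : Fin 2 => if i.val + j.val + 1 = 2 then (1 : L) else 0).map (algebraMap L (LocalRing L v))),
      c₀.IsConstituentOf (cmPrincipalSeries L 2 v χ) ∧ IrrClass.comap (cmDatumLocalCongr L v T ha h) c₀ ≠ c₀)
    (π : IrrClass ((cmDatum L 2 (Matrix.of fun i j : Fin 2 => if i.val + j.val + 1 = 2 then (1 : L) else 0)).Local v))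
    (hπ : π.IsConstituentOf (cmPrincipalSeries L 2 v χ))
    (T₀ : GL (Fin 2) (LocalRing L v)) {a₀ : LocalRing L v} (ha₀ : IsUnit a₀)
    (h₀ : formCongr (conjLocal L (IsCMField.complexConj L) v) T₀
      ((Matrix.of fun i j : Fin 2 => if i.val + j.val + 1 = 2 then (1 : L) else 0).map (algebraMap L (LocalRing L v))) =
      a₀ • (Matrix.of fun i j : Fin 2 => if i.val + j.val + 1 = 2 then (1 : L) else 0).map (algebraMap L (LocalRing L v)))
    (hn₀ : ¬ ∃ z : LocalRing L v, IsUnit z ∧ a₀ = conjLocal L (IsCMField.complexConj L) v z * z) :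
    IrrClass.comap (cmDatumLocalCongr L v T₀ ha₀ h₀) π ≠ π := by
  intro hfix
  obtain ⟨c₀, T, a, ha, h, hc₀, hmv⟩ := hmoved
  -- every similitude fixes `π` (§2), in particular the mover `T`
  have hT : IrrClass.comap (cmDatumLocalCongr L v T ha h) π = π :=
    comap_eq_self_of_outer_comap_eq_self L v hv T₀ ha₀ h₀ hn₀ π hfix T ha h
  have hperm : ∀ z, z = π₁ ∨ z = π₂ →
      IrrClass.comap (cmDatumLocalCongr L v T ha h) z = π₁ ∨ IrrClass.comap (cmDatumLocalCongr L v T ha h) z = π₂ :=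
    fun z hz => (hcons _).1 (isConstituentOf_comap_cmDatumLocalCongr_cmPrincipalSeries L v χ T a ha h ((hcons z).2 hz))
  have hinj := IrrClass.comap_injective (cmDatumLocalCongr L v T ha h)
  -- `π ≠ c₀` (else `T` would fix `c₀`), and then `T` swaps: `c₀ = π ∘ Ad(T) = π` — contradiction
  have hne0 : π ≠ c₀ := by
    rintro rfl
    exact hmv hT
  have e := eq_apply_of_pair_of_moved _ hinj hperm ((hcons c₀).1 hc₀) hmv ((hcons π).1 hπ) ((hcons c₀).1 hc₀) hne0
  exact hne0 (hT.symm.trans e.symm)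

/-! ## §5 Under the socket's guards: p05's `hTwo` + (SWAP) ⟹ p05's `hOrbit`, token for token -/

/-- **(ORBIT) FROM (TWO) AND (SWAP)** — the `hOrbit` binder of ★ `stub_R90_S4_H_lds_of_two_of_orbit` (R90-C131-p05, p861828) produced
VERBATIM from its `hTwo` binder and the sharper printed input (SWAP) «at a non-split `v`, a local similitude of `Φ₂` with NON-NORM multiplier
moves every constituent of `i_G((χ₁, χ₂))`, `χ₁|F_v^× = ω`» [§11.1 p. 161 case 2): «`JH(i_G(χ))` is an l.d.s. L-packet», i.e. ONE
`PGL₂(F)`-orbit; LabesseLanglands1979]: an outer similitude exists at non-split `v` (§1), (SWAP) says it moves `π₁`, and §3 concludes.  Hence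
`stub_R90_S4_H_lds_of_two_of_orbit hTwo (hOrbit_of_hTwo_of_swap hTwo hSwap)` pays socket S4#B5 modulo exactly (TWO) + (SWAP).
[cite: Rogawski1990, §11.1 p. 161; §12.1 p. 171] -/
theorem hOrbit_of_hTwo_of_swap
    (hTwo : ∀ (L : Type) [Field L] [NumberField L] [IsCMField L] (v : HeightOneSpectrum (𝓞 ↥(maximalRealSubfield L))),
      (∀ w : PlacesOver L v, IsCMField.complexConj L • w.1 = w.1) →
      ∀ (χ₁ : (LocalRing L v)ˣ →* ℂˣ) (χ₂ : ↥(normOneUnits (conjLocal L (IsCMField.complexConj L) v)) →* ℂˣ),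
        IsOpen ((χ₁.ker : Subgroup (LocalRing L v)ˣ) : Set (LocalRing L v)ˣ) →
        IsOpen ((χ₂.ker : Subgroup ↥(normOneUnits (conjLocal L (IsCMField.complexConj L) v))) :
          Set ↥(normOneUnits (conjLocal L (IsCMField.complexConj L) v))) →
        IsQuadraticCharExtension (conjLocal L (IsCMField.complexConj L) v) χ₁ →
        ∃ π₁ π₂ : IrrClass ((cmDatum L 2 (Matrix.of fun i j : Fin 2 => if i.val + j.val + 1 = 2 then (1 : L) else 0)).Local v),
          π₁ ≠ π₂ ∧ ∀ c, c.IsConstituentOf (cmPrincipalSeries L 2 v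
            (torusCharPair (conjLocal L (IsCMField.complexConj L) v) (cmLocalForm L 2 v) (cmLocalForm_eq_over L 2 v) 0 χ₁ χ₂)) ↔
              c = π₁ ∨ c = π₂)
    (hSwap : ∀ (L : Type) [Field L] [NumberField L] [IsCMField L] (v : HeightOneSpectrum (𝓞 ↥(maximalRealSubfield L))),
      (∀ w : PlacesOver L v, IsCMField.complexConj L • w.1 = w.1) →
      ∀ (χ₁ : (LocalRing L v)ˣ →* ℂˣ) (χ₂ : ↥(normOneUnits (conjLocal L (IsCMField.complexConj L) v)) →* ℂˣ),
        IsOpen ((χ₁.ker : Subgroup (LocalRing L v)ˣ) : Set (LocalRing L v)ˣ) →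
        IsOpen ((χ₂.ker : Subgroup ↥(normOneUnits (conjLocal L (IsCMField.complexConj L) v))) :
          Set ↥(normOneUnits (conjLocal L (IsCMField.complexConj L) v))) →
        IsQuadraticCharExtension (conjLocal L (IsCMField.complexConj L) v) χ₁ →
        ∀ π : IrrClass ((cmDatum L 2 (Matrix.of fun i j : Fin 2 => if i.val + j.val + 1 = 2 then (1 : L) else 0)).Local v),
          π.IsConstituentOf (cmPrincipalSeries L 2 v
            (torusCharPair (conjLocal L (IsCMField.complexConj L) v) (cmLocalForm L 2 v) (cmLocalForm_eq_over L 2 v) 0 χ₁ χ₂)) →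
          ∀ (T : GL (Fin 2) (LocalRing L v)) (a : LocalRing L v) (ha : IsUnit a)
            (h : formCongr (conjLocal L (IsCMField.complexConj L) v) T
              ((Matrix.of fun i j : Fin 2 => if i.val + j.val + 1 = 2 then (1 : L) else 0).map (algebraMap L (LocalRing L v))) =
              a • (Matrix.of fun i j : Fin 2 => if i.val + j.val + 1 = 2 then (1 : L) else 0).map (algebraMap L (LocalRing L v))),
            (¬ ∃ z : LocalRing L v, IsUnit z ∧ a = conjLocal L (IsCMField.complexConj L) v z * z) →
            IrrClass.comap (cmDatumLocalCongr L v T ha h) π ≠ π) :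
    ∀ (L : Type) [Field L] [NumberField L] [IsCMField L] (v : HeightOneSpectrum (𝓞 ↥(maximalRealSubfield L))),
      (∀ w : PlacesOver L v, IsCMField.complexConj L • w.1 = w.1) →
      ∀ (χ₁ : (LocalRing L v)ˣ →* ℂˣ) (χ₂ : ↥(normOneUnits (conjLocal L (IsCMField.complexConj L) v)) →* ℂˣ),
        IsOpen ((χ₁.ker : Subgroup (LocalRing L v)ˣ) : Set (LocalRing L v)ˣ) →
        IsOpen ((χ₂.ker : Subgroup ↥(normOneUnits (conjLocal L (IsCMField.complexConj L) v))) :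
          Set ↥(normOneUnits (conjLocal L (IsCMField.complexConj L) v))) →
        IsQuadraticCharExtension (conjLocal L (IsCMField.complexConj L) v) χ₁ →
        ∀ c c' : IrrClass ((cmDatum L 2 (Matrix.of fun i j : Fin 2 => if i.val + j.val + 1 = 2 then (1 : L) else 0)).Local v),
          c.IsConstituentOf (cmPrincipalSeries L 2 v
            (torusCharPair (conjLocal L (IsCMField.complexConj L) v) (cmLocalForm L 2 v) (cmLocalForm_eq_over L 2 v) 0 χ₁ χ₂)) →
          c'.IsConstituentOf (cmPrincipalSeries L 2 v
            (torusCharPair (conjLocal L (IsCMField.complexConj L) v) (cmLocalForm L 2 v) (cmLocalForm_eq_over L 2 v) 0 χ₁ χ₂)) →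
          ∃ (T : GL (Fin 2) (LocalRing L v)) (a : LocalRing L v) (ha : IsUnit a)
            (h : formCongr (conjLocal L (IsCMField.complexConj L) v) T
              ((Matrix.of fun i j : Fin 2 => if i.val + j.val + 1 = 2 then (1 : L) else 0).map (algebraMap L (LocalRing L v))) =
              a • (Matrix.of fun i j : Fin 2 => if i.val + j.val + 1 = 2 then (1 : L) else 0).map (algebraMap L (LocalRing L v))),
            c' = IrrClass.comap (cmDatumLocalCongr L v T ha h) c := by
  intro L _ _ _ v hv χ₁ χ₂ hχ₁ hχ₂ hq c c' hc hc'
  obtain ⟨π₁, π₂, -, hcons⟩ := hTwo L v hv χ₁ χ₂ hχ₁ hχ₂ hq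
  obtain ⟨T₀, a₀, ha₀, h₀, hn₀⟩ := exists_similitude_not_exists_norm L v hv
  have h₁ := (hcons π₁).2 (Or.inl rfl)
  have hmv : IrrClass.comap (cmDatumLocalCongr L v T₀ ha₀ h₀) π₁ ≠ π₁ :=
    hSwap L v hv χ₁ χ₂ hχ₁ hχ₂ hq π₁ h₁ T₀ a₀ ha₀ h₀ hn₀
  exact orbit_of_two_of_exists_moved L v
    (torusCharPair (conjLocal L (IsCMField.complexConj L) v) (cmLocalForm L 2 v) (cmLocalForm_eq_over L 2 v) 0 χ₁ χ₂)
    hcons ⟨π₁, T₀, a₀, ha₀, h₀, h₁, hmv⟩ c c' hc hc'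

end Summit.HodgeConjecture.HodgeConjecture.R90.S4

end
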